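import Mathlib
import HarnessLib
import Summits.ResolutionOfSingularities.ResolutionOfSingularities.Theorems.WildQuotientsWildQuotientResolutionS1aExitAssemblyBR
import Literature.AlgebraicGeometry.Resolution.BirationalDimensionInequality

/-!
# Line L `s1a-logminvertex`, skeleton v5: the tame EXIT ASSEMBLY `stub_exitAssemblyTame` (crux `CyclicQuotientFourfolds`,
# stmt-ResolutionOfSingularities-17941)

Topic: `Summits/ResolutionOfSingularities/ResolutionOfSingularities/Theorems`. Helper for the crux item
`CyclicQuotientFourfolds` (stmt-ResolutionOfSingularities-17941, route `WildQuotients`), def-free, `--supports … --as helper`.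

The registered skeleton v5 «GLOBAL FRAME + TAME DOOR» (`Cruxes/CyclicQuotientFourfolds/Lines/s1a_logminvertex.lean`,
sha16 47061bb625717adf) composes the frame stubs into `S1.GlobalKillTame p` and then needs the M-sized GLUE

    stub_exitAssemblyTame : ∀ p : ℕ, p.Prime → ⟨door⟩ → S1.GlobalKillTame p → S1.CyclicQuotientAt p

where `⟨door⟩` is the statement of `stub_tameQuotientResolution` (every integral separated finite-type quasi-compact
locally tame-root-regular `Y/k`, `k` perfect, of dimension `≤ 4`, has a resolution). This file PROVES the glue
(res-L1-w45c-plan-1, EXIT-DOOR-DESIGN v1 §1, ASSIGNMENT 2026-08-27T23:39:37Z), as the plumbing of line B's closed exit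
assembly `…S1aExitAssemblyBR` (`ExitAssemblyBR.hasResolution_of_killBRModel`, p-closed) with the DOOR in place of the
Bergh–Rydh fact:

* faithful `ρ`: unpack the KILL-TAME model `(V, π, ρ_B)`; the action on `V` is faithful (`ext_of_isDominant` along the
  dominant `π`); the quotient map `r : V/G → X₁` (`ActionOver.gluedDesc`) is proper (`ActionOver.isProper_gluedDesc`) and
  birational (W-clause `QuotientModel.exists_dense_isFinite_etale_bijective` + `Birational.stub_birational_of_bijective`);
  `V/G` is integral (`ActionOver.isIntegral_glued`) and its structure map `r ≫ f` is separated, locally of finite type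
  and quasi-compact; `dim V/G = dim X₁ ≤ 4` (`IsBirational.topologicalKrullDim_eq_of_isProper`); the model makes `V/G`
  locally tame-root-regular; the DOOR resolves `V/G`, and resolutions transfer along `r`
  (`ComponentGluing.Scheme.HasResolution.of_isBirational`);
* `ρ` not injective: `|G| = p` prime forces `ρ = 1`, and line B's `ExitAssemblyBR.hasResolution_of_trivial_action`
  applies verbatim; `dim X₁ ≤ 0`: `hasResolution_of_dim_le_one`.

* `hasResolution_of_killTameModel` — faithful case: door + KILL-TAME model ⇒ `HasResolution X₁`.
* `cyclicQuotientAt_of_globalKillTame` — door + `S1.GlobalKillTame p` ⇒ `S1.CyclicQuotientAt p`.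
* `stub_exitAssemblyTame_holds` — the registered stub statement VERBATIM (by-name closer for the skeleton holder:
  `stub_exitAssemblyTame := ExitAssemblyTame.stub_exitAssemblyTame_holds`).

UNCONDITIONAL (no named fact). [OURS · L1 W4.5c · v5 glue] Replaces the role of NO printed item; NOT a statement of
the manuscript [claim: Hironaka2017, status: under-review]. AI work, weaker than expert review.

## References

* res-L1-w45c-plan-1, EXIT-DOOR-DESIGN v1 (HOME `L/w45c/EXIT-DOOR-DESIGN.md` 0faa10b87b80dece) §1 (OURS, AI planning).
* H. Matsumura, *Commutative Ring Theory* (1987), Thm. 15.5 (dimension under proper birational maps, via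
  `IsBirational.topologicalKrullDim_eq_of_isProper`). [Matsumura1987]
-/

set_option linter.dupNamespace false -- mandated namespace of this single-conjunct summit

noncomputable section

open CategoryTheory Limits AlgebraicGeometry TopologicalSpace
open Literature.AlgebraicGeometry.Resolution Literature.AlgebraicGeometry.RelativeSpec

namespace Summit.ResolutionOfSingularities.ResolutionOfSingularities.Theorems.WildQuotientResolution.S1.ExitAssemblyTame

/-- **Faithful case.** The DOOR and a KILL-TAME model of a faithful datum over a perfect field resolve `X₁`
(`0 < dim X₁ ≤ 4`). [OURS · L1 W4.5c · v5 glue] -/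
theorem hasResolution_of_killTameModel
    (hdoor : ∀ (k : Type) [Field k] [PerfectField k] (Y : Scheme.{0}) (g : Y ⟶ Spec (.of k))
      [IsIntegral Y] [IsSeparated g] [LocallyOfFiniteType g] [QuasiCompact g],
      LocallyTameRootRegular Y → topologicalKrullDim Y ≤ 4 → Scheme.HasResolution Y)
    {k : Type} [Field k] [PerfectField k] {X' X₁ : Scheme.{0}} (f : X₁ ⟶ Spec (.of k))
    [IsSeparated f] [LocallyOfFiniteType f] [QuasiCompact f] [IsIntegral X₁] [IsIntegral X']
    (q : X' ⟶ X₁) [IsFinite q] (G : Type) [Group G] [Finite G] (ρ : G →* Aut X')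
    (hinj : Function.Injective ρ) (hsurj : Function.Surjective q.base)
    (hU : ∃ U : X₁.Opens, Dense (U : Set X₁) ∧ Etale (q ∣_ U))
    (horb : ∀ x y : X', q.base x = q.base y → ∃ g : G, (ρ g).hom.base x = y)
    (hdim : ¬ topologicalKrullDim X₁ ≤ 0) (hdim4 : topologicalKrullDim X₁ ≤ 4) (h : KillTameModel q G ρ) :
    Scheme.HasResolution X₁ := by
  classical
  obtain ⟨V, π, hX₁sep, hsep, ρB, hπprop, hπbir, hVint, -, hequiv, hcov, htame⟩ := h
  haveI := hX₁sep
  haveI := hsep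
  haveI := hπprop
  haveI := hVint
  haveI : IsLocallyNoetherian X₁ := LocallyOfFiniteType.isLocallyNoetherian f
  haveI : X'.IsSeparated := ⟨by rw [← terminal.comp_from (q ≫ f)]; infer_instance⟩
  haveI : IsDominant π := hπbir.isDominant
  -- the action on `V` is faithful
  have hinjB : Function.Injective ρB.aut := by
    intro g g' hgg'
    apply hinj
    have hc : π ≫ (ρ g).hom = π ≫ (ρ g').hom := by rw [← hequiv g, ← hequiv g', hgg']
    exact Iso.ext (ext_of_isDominant π hc)
  -- the quotient `r : V/G → X₁` is proper and birational, `V/G` is integral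
  haveI hY : IsIntegral ρB.glued := ρB.isIntegral_glued hcov
  haveI hr : IsProper (ρB.gluedDesc (π ≫ q) ρB.aut_comp) :=
    ρB.isProper_gluedDesc hcov (π ≫ q) ρB.aut_comp (𝟙 X₁) (Category.comp_id _)
  obtain ⟨W, hWd, hWfin, hWet, hWbij⟩ :=
    QuotientModel.exists_dense_isFinite_etale_bijective π q ρB hcov hinjB ρ hequiv horb hsurj hU hπbir
  haveI := hWfin
  haveI := hWet
  have hrbir : IsBirational (ρB.gluedDesc (π ≫ q) ρB.aut_comp) :=
    Birational.stub_birational_of_bijective k f (ρB.gluedDesc (π ≫ q) ρB.aut_comp) hdim W hWd hWbij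
  -- `dim V/G = dim X₁ ≤ 4`
  have hdimY : topologicalKrullDim ρB.glued ≤ 4 := by
    rw [hrbir.topologicalKrullDim_eq_of_isProper]
    exact hdim4
  -- the door resolves `V/G` (its structure map `r ≫ f` inherits the instance binders), and resolutions transfer along `r`
  have hYres : Scheme.HasResolution ρB.glued :=
    hdoor k ρB.glued (ρB.gluedDesc (π ≫ q) ρB.aut_comp ≫ f) htame hdimY
  exact ComponentGluing.Scheme.HasResolution.of_isBirational (ρB.gluedDesc (π ≫ q) ρB.aut_comp) hrbir hYres

/-- **The glue, proved**: the DOOR and `S1.GlobalKillTame p` give `S1.CyclicQuotientAt p` (faithful case by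
`hasResolution_of_killTameModel`; `ρ` non-injective ⇒ trivial, by line B's `ExitAssemblyBR.hasResolution_of_trivial_action`;
`dim X₁ ≤ 0` by `hasResolution_of_dim_le_one`). [OURS · L1 W4.5c · v5 glue] -/
theorem cyclicQuotientAt_of_globalKillTame
    (hdoor : ∀ (k : Type) [Field k] [PerfectField k] (Y : Scheme.{0}) (g : Y ⟶ Spec (.of k))
      [IsIntegral Y] [IsSeparated g] [LocallyOfFiniteType g] [QuasiCompact g],
      LocallyTameRootRegular Y → topologicalKrullDim Y ≤ 4 → Scheme.HasResolution Y)
    (p : ℕ) (hp : p.Prime) (hG : GlobalKillTame p) : S1.CyclicQuotientAt p := by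
  intro k _ _ _ X' X₁ f q G _ _ ρ hcard hsep hlft hqc hX₁ hX' hreg hfin hsurj hU hρ horb hdim
  haveI := hsep
  haveI := hlft
  haveI := hqc
  haveI := hX₁
  haveI := hX'
  haveI := hfin
  classical
  by_cases hdim0 : topologicalKrullDim X₁ ≤ 0
  · exact hasResolution_of_dim_le_one X₁ f (hdim0.trans zero_le_one)
  by_cases hinj : Function.Injective ρ
  · exact hasResolution_of_killTameModel hdoor f q G ρ hinj hsurj hU horb hdim0 hdim
      (hG k X' X₁ f q G ρ hcard hsep hlft hqc hX₁ hX' hreg hfin hsurj hU hρ horb hdim hinj)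
  · -- `|G| = p` prime and `ρ` not injective ⇒ `ρ` trivial
    have htriv : ∀ g : G, ρ g = 1 := by
      haveI : Fact (Nat.card G).Prime := ⟨by rw [hcard]; exact hp⟩
      rcases ρ.ker.eq_bot_or_eq_top_of_prime_card with h | h
      · exact absurd ((MonoidHom.ker_eq_bot_iff ρ).mp h) hinj
      · intro g
        exact (MonoidHom.mem_ker).mp (h ▸ Subgroup.mem_top g)
    exact ExitAssemblyBR.hasResolution_of_trivial_action f q G ρ htriv hreg hsurj hU horb hdim0

/-- **The registered stub statement `stub_exitAssemblyTame` of `Lines/s1a_logminvertex.lean` (47061bb625717adf),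
VERBATIM** — by-name closer for the skeleton holder (`stub_exitAssemblyTame := ExitAssemblyTame.stub_exitAssemblyTame_holds`).
UNCONDITIONAL. [OURS · L1 W4.5c · v5 glue] -/
theorem stub_exitAssemblyTame_holds :
    ∀ p : ℕ, p.Prime →
      (∀ (k : Type) [Field k] [PerfectField k] (Y : Scheme.{0}) (g : Y ⟶ Spec (.of k))
        [IsIntegral Y] [IsSeparated g] [LocallyOfFiniteType g] [QuasiCompact g],
        S1.LocallyTameRootRegular Y → topologicalKrullDim Y ≤ 4 →
        Literature.AlgebraicGeometry.Resolution.Scheme.HasResolution Y) →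
      S1.GlobalKillTame p → S1.CyclicQuotientAt p :=
  fun p hp hdoor hG => cyclicQuotientAt_of_globalKillTame hdoor p hp hG

/-- **BY-NAME CLOSER of the registered stub `stub_exitAssemblyTame`** of `Lines/s1a_logminvertex.lean` (47061bb625717adf):
short name and signature VERBATIM (res-L1-w45c-plan-1 NAMING RULING 2026-08-27T23:45:21Z, chain rule «registered stubs BY
NAME AND SIGNATURE»; precedents `S1.stub_blowupNodeAtlas` p586157, `S1.stub_W1N_print` p578139). UNCONDITIONAL.
[OURS · L1 W4.5c · v5 glue] -/
theorem stub_exitAssemblyTame :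
    ∀ p : ℕ, p.Prime →
      (∀ (k : Type) [Field k] [PerfectField k] (Y : Scheme.{0}) (g : Y ⟶ Spec (.of k))
        [IsIntegral Y] [IsSeparated g] [LocallyOfFiniteType g] [QuasiCompact g],
        S1.LocallyTameRootRegular Y → topologicalKrullDim Y ≤ 4 →
        Literature.AlgebraicGeometry.Resolution.Scheme.HasResolution Y) →
      S1.GlobalKillTame p → S1.CyclicQuotientAt p :=
  stub_exitAssemblyTame_holds

end Summit.ResolutionOfSingularities.ResolutionOfSingularities.Theorems.WildQuotientResolution.S1.ExitAssemblyTame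

end
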